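import Summits.AnomalousDissipation.AnomalousDissipation.Theorems.SolenoidalFractalHomogenisationLagrangianStepD1Split
import Summits.AnomalousDissipation.AnomalousDissipation.Theorems.SolenoidalFractalHomogenisationLagrangianStepD1Family
import Summits.AnomalousDissipation.AnomalousDissipation.Theorems.SolenoidalFractalHomogenisationLagrangianStepWCrossingRelSmallAlgebra

/-!
# K1L_D (stmt-AnomalousDissipation-27980): glue for the registry-v16 stub `stub_D1_residue` — residue from a PAIR CERTIFICATE plus a TAIL bound
(helper, `--supports 27980 --as helper`; prover ad-k1loc-p3 g8 on the acting lead's offer «TAKES-p3-g8 #9»; consumed by registry v17 and by the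
Theorems port of planner ad-ideate-p5's CERT-(i) v0)

Registry v16 (planner ad-ideate-p1 g26) registers
`stub_D1_residue : ∀ a > 0, ∀ ν ∈ Ioc 0 νB₁, ∀ S, NearIso S (10/11) (11/10) → ∀ τ ∈ Icc 0 (1/20), OddSectorial S τ →
RelSmall (ΨB₁ a ν S - ΦB a S) (ΦB a S) ρB` for the named exact family `ΨB₁ a ν S = a • Sideband.psiStar cubatureWord MB MB_pos ν S`
(`…D1Family`, p687442) against the branch-B design map `ΦB a S = a • excQS cubatureWord MB S` (`…WCrossingWindow`), budget `ρB = 3/25000`.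
The proof of record (tenure D26-7, variant A) splits the residue into the colinear adjacent PAIR-MEMORY term `a • pairT S`, certified by a
finite certificate `RelSmall (pairT S) (excQS cubatureWord MB S) ρP` (planner ad-ideate-p5 g13, CERT-(i) v0, `ρP = 115/10⁶`), and a TAIL
(higher Duhamel levels, non-adjacent memory, period wrap; prover ad-sawtooth-k1loc-p1 g12, A1/A4) of size `ρB − ρP` in the same currency.

This file is the GLUE ONLY, with the pair tensor `pairT` and its size `ρP` ABSTRACT (so it serves whichever Theorems-side pair declaration lands):
* `relSmall_residue_of_pair_tail` — pointwise: pair certificate + tail bound relative to `ΦB a S` ⇒ residue bound at `ρ` (`RelSmall.smul` + `RelSmall.add`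
  + `transNonneg_ΦB`);
* `D1Residue_of_pair_tail` — the registered `stub_D1_residue` text VERBATIM as conclusion, from a pair certificate at `ρP ≤ ρB` and a tail bound
  `RelSmall (ΨB₁ a ν S - ΦB a S - a • pairT S) (ΦB a S) (ρB - ρP)` for every `a > 0`, `ν ∈ (0, νB₁]` (planner p5's `clause_i_of_pair_tail` shape);
* `D1Residue_of_pair_tail_unit` — the same from UNIT-NORMALISATION data: pair certificate at `ρP` and tail bound
  `RelSmall (psiStar ν S - excQS S - pairT S) (excQS S) ρT` with `ρP + ρT ≤ ρB` (the whole stub is `a`-free: `ΨB₁ a ν S - ΦB a S = a • (psiStar ν S - excQS S)`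
  and `RelSmall` is scale-invariant);
* `D1Residue_of_unit` — no split at all: a residue bound `RelSmall (psiStar ν S - excQS S) (excQS S) ρ₁`, `ρ₁ ≤ ρB`, on the window gives the stub.
Also `transNonneg_excQS_block` (the block-window transverse nonnegativity of `excQS cubatureWord MB S`, extracted from `transNonneg_ΦB`) and
`ΨB₁_sub_ΦB` (the `a`-factorisation of the residue).  No sorry, no named fact, no definition.  NOT a proof of `stub_D1_residue` (the pair certificate
port and the tail lemma are separate files); K1L_D open; rung F-D1.A0; AD not claimed.
-/

set_option linter.dupNamespace false

namespace Summit.AnomalousDissipation.AnomalousDissipation.Theorems.SolenoidalFractalHomogenisation.LagrangianStep.WCrossing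

open Summit.AnomalousDissipation.AnomalousDissipation.Theorems
open Summit.AnomalousDissipation.AnomalousDissipation.Theorems.SolenoidalFractalHomogenisation.LagrangianStep
open Literature.Analysis Literature.Analysis.FluidPDE Literature.Analysis.FunctionSpaces
open Set

noncomputable section

/-- On the block window `NearIso S (10/11) (11/10)`, `OddSectorial S τ`, `τ ≤ 1/20`, the quasi-static excess `excQS cubatureWord MB S` is transversely
nonnegative (even pinch from below by `0.97·gainForm(11/10)/(11/10) ≥ 0`, `OddGain.evenPinch_excQS_design_point'`, `gainForm_nonneg`). [folklore] -/
theorem transNonneg_excQS_block {S : T4} (hS : Torus.NearIso S (10 / 11) (11 / 10)) {τ : ℝ} (hτ : τ ∈ Set.Icc (0:ℝ) (1 / 20))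
    (hodd : OddSectorial S τ) : TransNonneg (excQS cubatureWord MB S) := by
  intro k p _
  have h := (OddGain.evenPinch_excQS_design_point' (Mlag := MB) (le_of_eq rfl) ⟨hτ.1, hτ.2.trans (by norm_num)⟩ hS hodd k p).1
  have hg : 0 ≤ gainForm cubatureWord MB (11 / 10) k p := gainForm_nonneg cubatureWord MB_pos.le (by norm_num) k p
  have : 0 ≤ 97 / 100 * (gainForm cubatureWord MB (11 / 10) k p / (11 / 10)) := by positivity
  exact this.trans h

/-- The residue of the named family factors through the normalisation: `ΨB₁ a ν S - ΦB a S = a • (psiStar ν S - excQS S)`. [folklore] -/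
theorem ΨB₁_sub_ΦB (a ν : ℝ) (S : T4) :
    ΨB₁ a ν S - ΦB a S = a • (Sideband.psiStar cubatureWord MB MB_pos ν S - excQS cubatureWord MB S) := by
  rw [ΨB₁_apply, smul_sub]
  rfl

/-- **Pointwise glue.**  If the pair tensor is `ρP`-small relative to `excQS cubatureWord MB S` on the block window and, at a window point `S`, the
remainder `Ψ ν S - ΦB a S - a • pairT S` is `(ρ - ρP)`-small relative to `ΦB a S` (`a ≥ 0`, `0 ≤ ρP ≤ ρ`), then the residue `Ψ ν S - ΦB a S` is
`ρ`-small relative to `ΦB a S` (scale invariance + subadditivity of `RelSmall` over the transversely nonnegative `ΦB a S`). [folklore] -/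
theorem relSmall_residue_of_pair_tail {Ψ : ℝ → T4 → T4} {pairT : T4 → T4} {a ρP ρ : ℝ} (ha : 0 ≤ a) (h0 : 0 ≤ ρP)
    (hle : ρP ≤ ρ)
    (hP : ∀ S : T4, Torus.NearIso S (10 / 11) (11 / 10) → ∀ τ ∈ Set.Icc (0:ℝ) (1 / 20), OddSectorial S τ →
      RelSmall (pairT S) (excQS cubatureWord MB S) ρP)
    {ν : ℝ} {S : T4} (hS : Torus.NearIso S (10 / 11) (11 / 10)) {τ : ℝ} (hτ : τ ∈ Set.Icc (0:ℝ) (1 / 20))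
    (hodd : OddSectorial S τ) (hT : RelSmall (Ψ ν S - ΦB a S - a • pairT S) (ΦB a S) (ρ - ρP)) :
    RelSmall (Ψ ν S - ΦB a S) (ΦB a S) ρ := by
  have hA : TransNonneg (ΦB a S) := transNonneg_ΦB ha hS hτ hodd
  have h1 : RelSmall (a • pairT S) (ΦB a S) ρP := (hP S hS τ hτ hodd).smul a
  have h := RelSmall.add h1 hT hA h0 (sub_nonneg.mpr hle)
  have e : a • pairT S + (Ψ ν S - ΦB a S - a • pairT S) = Ψ ν S - ΦB a S := by abel
  rw [e, show ρP + (ρ - ρP) = ρ by ring] at h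
  exact h

/-- **`stub_D1_residue` (registry v16 text verbatim) from a PAIR CERTIFICATE and a TAIL bound** in planner p5's shape: the pair tensor `pairT` is
`ρP`-small relative to `excQS cubatureWord MB S` on the block window (`0 ≤ ρP ≤ ρB`), and for every `a > 0`, `ν ∈ (0, νB₁]` the remainder
`ΨB₁ a ν S - ΦB a S - a • pairT S` is `(ρB - ρP)`-small relative to `ΦB a S`. [folklore] -/
theorem D1Residue_of_pair_tail {pairT : T4 → T4} {ρP : ℝ} (h0 : 0 ≤ ρP) (hle : ρP ≤ ρB)
    (hP : ∀ S : T4, Torus.NearIso S (10 / 11) (11 / 10) → ∀ τ ∈ Set.Icc (0:ℝ) (1 / 20), OddSectorial S τ →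
      RelSmall (pairT S) (excQS cubatureWord MB S) ρP)
    (hT : ∀ a > (0:ℝ), ∀ ν ∈ Set.Ioc 0 νB₁, ∀ S : T4, Torus.NearIso S (10 / 11) (11 / 10) →
      ∀ τ ∈ Set.Icc (0:ℝ) (1 / 20), OddSectorial S τ →
        RelSmall (ΨB₁ a ν S - ΦB a S - a • pairT S) (ΦB a S) (ρB - ρP)) :
    ∀ a > (0:ℝ), ∀ ν ∈ Set.Ioc 0 νB₁, ∀ S, Torus.NearIso S (10 / 11) (11 / 10) →
      ∀ τ ∈ Set.Icc (0:ℝ) (1 / 20), OddSectorial S τ →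
        RelSmall (ΨB₁ a ν S - ΦB a S) (ΦB a S) ρB := by
  intro a ha ν hν S hS τ hτ hodd
  exact relSmall_residue_of_pair_tail ha.le h0 hle hP hS hτ hodd (hT a ha ν hν S hS τ hτ hodd)

/-- **`stub_D1_residue` from UNIT-NORMALISATION data**: a pair certificate `RelSmall (pairT S) (excQS S) ρP` and a tail bound
`RelSmall (psiStar ν S - excQS S - pairT S) (excQS S) ρT` on the block window for `ν ∈ (0, νB₁]`, with `ρP, ρT ≥ 0`, `ρP + ρT ≤ ρB`, give the registered
text for EVERY `a > 0` (`ΨB₁ a ν S - ΦB a S = a • (psiStar ν S - excQS S)`; `RelSmall.smul`, `RelSmall.add`, `RelSmall.mono`). [folklore] -/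
theorem D1Residue_of_pair_tail_unit {pairT : T4 → T4} {ρP ρT : ℝ} (h0 : 0 ≤ ρP) (hT0 : 0 ≤ ρT) (hle : ρP + ρT ≤ ρB)
    (hP : ∀ S : T4, Torus.NearIso S (10 / 11) (11 / 10) → ∀ τ ∈ Set.Icc (0:ℝ) (1 / 20), OddSectorial S τ →
      RelSmall (pairT S) (excQS cubatureWord MB S) ρP)
    (hT : ∀ ν ∈ Set.Ioc 0 νB₁, ∀ S : T4, Torus.NearIso S (10 / 11) (11 / 10) →
      ∀ τ ∈ Set.Icc (0:ℝ) (1 / 20), OddSectorial S τ →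
        RelSmall (Sideband.psiStar cubatureWord MB MB_pos ν S - excQS cubatureWord MB S - pairT S) (excQS cubatureWord MB S) ρT) :
    ∀ a > (0:ℝ), ∀ ν ∈ Set.Ioc 0 νB₁, ∀ S, Torus.NearIso S (10 / 11) (11 / 10) →
      ∀ τ ∈ Set.Icc (0:ℝ) (1 / 20), OddSectorial S τ →
        RelSmall (ΨB₁ a ν S - ΦB a S) (ΦB a S) ρB := by
  intro a ha ν hν S hS τ hτ hodd
  have hE : TransNonneg (excQS cubatureWord MB S) := transNonneg_excQS_block hS hτ hodd
  have h := RelSmall.add (hP S hS τ hτ hodd) (hT ν hν S hS τ hτ hodd) hE h0 hT0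
  have e : pairT S + (Sideband.psiStar cubatureWord MB MB_pos ν S - excQS cubatureWord MB S - pairT S)
      = Sideband.psiStar cubatureWord MB MB_pos ν S - excQS cubatureWord MB S := by abel
  rw [e] at h
  have h' := (h.mono hE (add_nonneg h0 hT0) hle).smul a
  rw [← ΨB₁_sub_ΦB] at h'
  exact h'

/-- **`stub_D1_residue` is `a`-free**: a residue bound at unit normalisation, `RelSmall (psiStar ν S - excQS S) (excQS S) ρ₁` on the block window for
`ν ∈ (0, νB₁]` with `0 ≤ ρ₁ ≤ ρB`, gives the registered text for every `a > 0`. [folklore] -/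
theorem D1Residue_of_unit {ρ₁ : ℝ} (h0 : 0 ≤ ρ₁) (hle : ρ₁ ≤ ρB)
    (h : ∀ ν ∈ Set.Ioc 0 νB₁, ∀ S : T4, Torus.NearIso S (10 / 11) (11 / 10) →
      ∀ τ ∈ Set.Icc (0:ℝ) (1 / 20), OddSectorial S τ →
        RelSmall (Sideband.psiStar cubatureWord MB MB_pos ν S - excQS cubatureWord MB S) (excQS cubatureWord MB S) ρ₁) :
    ∀ a > (0:ℝ), ∀ ν ∈ Set.Ioc 0 νB₁, ∀ S, Torus.NearIso S (10 / 11) (11 / 10) →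
      ∀ τ ∈ Set.Icc (0:ℝ) (1 / 20), OddSectorial S τ →
        RelSmall (ΨB₁ a ν S - ΦB a S) (ΦB a S) ρB := by
  intro a ha ν hν S hS τ hτ hodd
  have hE : TransNonneg (excQS cubatureWord MB S) := transNonneg_excQS_block hS hτ hodd
  have h' := ((h ν hν S hS τ hτ hodd).mono hE h0 hle).smul a
  rw [← ΨB₁_sub_ΦB] at h'
  exact h'

end

end Summit.AnomalousDissipation.AnomalousDissipation.Theorems.SolenoidalFractalHomogenisation.LagrangianStep.WCrossing
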